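import Literature.NumberTheory.Sieve.BombieriFriedlanderIwaniecTheorem9Proofs
import Literature.NumberTheory.Sieve.BombieriFriedlanderIwaniecDyadic
import Literature.NumberTheory.Sieve.BombieriFriedlanderIwaniecTheorem7StarBlocks
import Literature.NumberTheory.Sieve.DivisorBound
import Literature.NumberTheory.LFunctions.PrimeNumberTheoremErrorTermProofs
import HarnessLib

/-!
# Bombieri–Friedlander–Iwaniec 1986, Theorem 9: reduction to the sifted dyadic form

Topic `Literature/NumberTheory/Sieve`, sibling of
`Literature.NumberTheory.Sieve.BombieriFriedlanderIwaniecTheorem9Proofs`.  Everything here is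
PROVED; no named fact is introduced.

E. Bombieri, J. B. Friedlander, H. Iwaniec, *Primes in arithmetic progressions to large moduli*,
Acta Math. 156 (1986), 203–251, prove Theorem 9 (§1, p. 209; named fact
`Literature.NumberTheory.Sieve.BombieriFriedlanderIwaniecTheorem9`) in §16 by the method of §15,
which opens (p. 244) with "the trivial observation that it is enough to prove (15.1)": the estimate
for the *dyadic, balanced, sifted* discrepancies
`E_z(x; d, a) = ∑_{x<n≤2x, n≡a (d), (n,P(z))=1} Λ(n) − φ(d)⁻¹ ∑_{x<n≤2x, (n,dP(z))=1} Λ(n)`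
(`Literature.NumberTheory.Sieve.BFI.dyadDiscSifted`).  This file carries out that observation for
the moduli `d = qr` and weights of Theorem 9 in its signed form
(`BombieriFriedlanderIwaniecTheorem9_iff_signed`: `γ_q = 1_{q ≤ Q, (q,a)=1}`, real `|δ_r| ≤ 1` on
`r ≤ R, (r, a) = 1`), following `Literature.NumberTheory.Sieve.BombieriFriedlanderIwaniecTheorem10_of_dyadic`
and `Literature.NumberTheory.Sieve.BFI.Theorem10Dyadic_of_sifted` for Theorem 10:

* `BFI.thm9Signed_of_dyadic` — from the balanced dyadic discrepancies `E(x; qr, a)`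
  (`BFI.dyadDisc`) to `ψ(x; qr, a) − x/φ(qr)`: telescoping over `x/2^{k+1}`, `2^K ≍ ℒ^{A+5}`
  (`T₂`), the trivial bound for `ψ(x/2^K; qr, a)` (`T₁`), and the prime number theorem with the
  de la Vallée Poussin error term (a theorem of the tree, `LFunctions.ChebyshevPsiDeLaValleePoussin_holds`)
  for the main terms (`T₃`), against `∑_{q ≤ Q, r ≤ R} 1/φ(qr) ≤ (1 + log Q)²(1 + log R)²`
  (`φ(qr) ≥ φ(q)φ(r)`);
* `BFI.thm9Dyadic_of_sifted` — unsifting (any `z(x) ≤ x`): the difference consists of proper prime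
  powers in `(x, 2x]`, each lying in at most `τ(n − a)² ≪ x^{1/4}` of the progressions `a (mod qr)`
  (`BFI.sum_sum_dvd_indicator_le`), of total weight `ψ(2x) − ϑ(2x) ≪ √x log x`;
* `BombieriFriedlanderIwaniecTheorem9.of_sifted` — the composition with
  `BombieriFriedlanderIwaniecTheorem9.of_signed`: Theorem 9 follows from the sifted signed dyadic
  estimate for pairs of moduli, the statement §16 derives from Theorems 6 and 7*.

## References

* E. Bombieri, J. B. Friedlander, H. Iwaniec, *Primes in arithmetic progressions to large moduli*,
  Acta Math. 156 (1986), 203–251: §1 Theorem 9 p. 209; §15 (15.1) p. 244; §16 p. 250.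
  [BombieriFriedlanderIwaniecActa1986]
-/

open Finset Real Filter
open scoped ArithmeticFunction.vonMangoldt ArithmeticFunction.sigma Chebyshev

namespace Literature.NumberTheory.Sieve

namespace BFI

/-! ### Sums of `1/φ(qr)` over pairs -/

/-- `φ(qr)⁻¹ ≤ φ(q)⁻¹ φ(r)⁻¹` for `q, r ≥ 1` (`φ` is super-multiplicative). [folklore] -/
theorem totient_mul_inv_le {q r : ℕ} (hq : 1 ≤ q) (hr : 1 ≤ r) :
    ((Nat.totient (q * r) : ℝ))⁻¹ ≤ ((Nat.totient q : ℝ))⁻¹ * ((Nat.totient r : ℝ))⁻¹ := by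
  have hq0 : (0 : ℝ) < Nat.totient q := by exact_mod_cast Nat.totient_pos.2 hq
  have hr0 : (0 : ℝ) < Nat.totient r := by exact_mod_cast Nat.totient_pos.2 hr
  rw [← mul_inv, inv_le_inv₀ (by exact_mod_cast Nat.totient_pos.2 (Nat.mul_pos hq hr)) (mul_pos hq0 hr0)]
  exact_mod_cast Nat.totient_super_multiplicative q r

/-- `∑_{r ≤ Rn} ∑_{q ≤ Qn} φ(qr)⁻¹ ≤ (1 + log Qn)² (1 + log Rn)²`. [folklore] -/
theorem sum_sum_totient_mul_inv_le (Qn Rn : ℕ) :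
    ∑ r ∈ Icc 1 Rn, ∑ q ∈ Icc 1 Qn, ((Nat.totient (q * r) : ℝ))⁻¹ ≤
      (1 + Real.log Qn) ^ 2 * (1 + Real.log Rn) ^ 2 := by
  calc ∑ r ∈ Icc 1 Rn, ∑ q ∈ Icc 1 Qn, ((Nat.totient (q * r) : ℝ))⁻¹
      ≤ ∑ r ∈ Icc 1 Rn, ∑ q ∈ Icc 1 Qn, ((Nat.totient q : ℝ))⁻¹ * ((Nat.totient r : ℝ))⁻¹ :=
        Finset.sum_le_sum fun r hr => Finset.sum_le_sum fun q hq =>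
          totient_mul_inv_le (mem_Icc.1 hq).1 (mem_Icc.1 hr).1
    _ = ∑ r ∈ Icc 1 Rn, ((Nat.totient r : ℝ))⁻¹ * totientInvSum Qn := by
        refine Finset.sum_congr rfl fun r _ => ?_
        rw [totientInvSum, Finset.mul_sum]
        exact Finset.sum_congr rfl fun q _ => by ring
    _ = totientInvSum Rn * totientInvSum Qn := by simp only [totientInvSum, Finset.sum_mul]
    _ ≤ (1 + Real.log Rn) ^ 2 * (1 + Real.log Qn) ^ 2 :=
        mul_le_mul (totientInvSum_le Rn) (totientInvSum_le Qn) (totientInvSum_nonneg Qn)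
          (by positivity)
    _ = (1 + Real.log Qn) ^ 2 * (1 + Real.log Rn) ^ 2 := by ring

/-- `∑_{r ≤ Rn} ∑_{q ≤ Qn} (qr)⁻¹ ≤ (1 + log Qn)(1 + log Rn)`. [folklore] -/
theorem sum_sum_mul_inv_le (Qn Rn : ℕ) :
    ∑ r ∈ Icc 1 Rn, ∑ q ∈ Icc 1 Qn, ((q : ℝ) * r)⁻¹ ≤ (1 + Real.log Qn) * (1 + Real.log Rn) := by
  have h0 : ∀ N : ℕ, 0 ≤ ∑ q ∈ Icc 1 N, ((q : ℝ))⁻¹ := fun N =>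
    Finset.sum_nonneg fun _ _ => inv_nonneg.2 (Nat.cast_nonneg _)
  calc ∑ r ∈ Icc 1 Rn, ∑ q ∈ Icc 1 Qn, ((q : ℝ) * r)⁻¹
      = ∑ r ∈ Icc 1 Rn, ((r : ℝ))⁻¹ * ∑ q ∈ Icc 1 Qn, ((q : ℝ))⁻¹ := by
        refine Finset.sum_congr rfl fun r _ => ?_
        rw [Finset.mul_sum]
        exact Finset.sum_congr rfl fun q _ => by rw [mul_inv]; ring
    _ = (∑ r ∈ Icc 1 Rn, ((r : ℝ))⁻¹) * ∑ q ∈ Icc 1 Qn, ((q : ℝ))⁻¹ := by rw [Finset.sum_mul]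
    _ ≤ (1 + Real.log Rn) * (1 + Real.log Qn) :=
        mul_le_mul (harmonic_Icc_le Rn) (harmonic_Icc_le Qn) (h0 Qn) (by
          have := Real.log_natCast_nonneg Rn; linarith)
    _ = (1 + Real.log Qn) * (1 + Real.log Rn) := by ring

/-! ### The trivial parts `T₁`, `T₃` of the dyadic reduction, for pairs of moduli -/

/-- `T₁` for pairs: `|∑_{r ≤ Rn, pR} δ_r ∑_{q ≤ Qn, pQ} ψ(y; qr, a)| ≤ log y · (y (1 + log Qn)(1 + log Rn) + Qn Rn)`
for `|δ| ≤ 1`, `y ≥ 1`. [folklore] -/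
theorem abs_pairSum_chebyshevPsiMod_le (Qn Rn : ℕ) (pQ pR : ℕ → Prop) [DecidablePred pQ]
    [DecidablePred pR] {δ : ℕ → ℝ} (hδ : ∀ r, |δ r| ≤ 1) (a : ℤ) {y : ℝ} (hy : 1 ≤ y) :
    |∑ r ∈ (Icc 1 Rn).filter pR, δ r * ∑ q ∈ (Icc 1 Qn).filter pQ,
        LevelOfDistribution.chebyshevPsiMod (q * r) (a : ZMod (q * r)) y| ≤
      Real.log y * (y * ((1 + Real.log Qn) * (1 + Real.log Rn)) + Qn * Rn) := by
  have hy0 : 0 ≤ y := zero_le_one.trans hy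
  have hlog0 : 0 ≤ Real.log y := Real.log_nonneg hy
  have hψ0 : ∀ d : ℕ, 0 ≤ LevelOfDistribution.chebyshevPsiMod d (a : ZMod d) y := fun d =>
    Finset.sum_nonneg fun n _ => ArithmeticFunction.vonMangoldt.residueClass_nonneg _ _
  have hinner : ∀ r ∈ Icc 1 Rn, |δ r * ∑ q ∈ (Icc 1 Qn).filter pQ,
      LevelOfDistribution.chebyshevPsiMod (q * r) (a : ZMod (q * r)) y| ≤
      ∑ q ∈ Icc 1 Qn, Real.log y * (y * ((q : ℝ) * r)⁻¹ + 1) := by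
    intro r hr
    have hr1 : 1 ≤ r := (mem_Icc.1 hr).1
    have hS0 : 0 ≤ ∑ q ∈ (Icc 1 Qn).filter pQ,
        LevelOfDistribution.chebyshevPsiMod (q * r) (a : ZMod (q * r)) y :=
      Finset.sum_nonneg fun q _ => hψ0 _
    rw [abs_mul, abs_of_nonneg hS0]
    calc |δ r| * ∑ q ∈ (Icc 1 Qn).filter pQ,
          LevelOfDistribution.chebyshevPsiMod (q * r) (a : ZMod (q * r)) y
        ≤ 1 * ∑ q ∈ (Icc 1 Qn).filter pQ,
          LevelOfDistribution.chebyshevPsiMod (q * r) (a : ZMod (q * r)) y :=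
          mul_le_mul_of_nonneg_right (hδ r) hS0
      _ ≤ ∑ q ∈ Icc 1 Qn, LevelOfDistribution.chebyshevPsiMod (q * r) (a : ZMod (q * r)) y := by
          rw [one_mul]
          exact Finset.sum_le_sum_of_subset_of_nonneg (Finset.filter_subset _ _) fun q _ _ => hψ0 _
      _ ≤ ∑ q ∈ Icc 1 Qn, Real.log y * (y / ((q * r : ℕ) : ℝ) + 1) :=
          Finset.sum_le_sum fun q hq =>
            chebyshevPsiMod_le_log_mul (Nat.mul_pos (mem_Icc.1 hq).1 hr1) _ hy
      _ = ∑ q ∈ Icc 1 Qn, Real.log y * (y * ((q : ℝ) * r)⁻¹ + 1) := by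
          refine Finset.sum_congr rfl fun q _ => ?_
          push_cast
          rw [div_eq_mul_inv]
  calc |∑ r ∈ (Icc 1 Rn).filter pR, δ r * ∑ q ∈ (Icc 1 Qn).filter pQ,
          LevelOfDistribution.chebyshevPsiMod (q * r) (a : ZMod (q * r)) y|
      ≤ ∑ r ∈ (Icc 1 Rn).filter pR, |δ r * ∑ q ∈ (Icc 1 Qn).filter pQ,
          LevelOfDistribution.chebyshevPsiMod (q * r) (a : ZMod (q * r)) y| :=
        Finset.abs_sum_le_sum_abs _ _
    _ ≤ ∑ r ∈ Icc 1 Rn, |δ r * ∑ q ∈ (Icc 1 Qn).filter pQ,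
          LevelOfDistribution.chebyshevPsiMod (q * r) (a : ZMod (q * r)) y| :=
        Finset.sum_le_sum_of_subset_of_nonneg (Finset.filter_subset _ _) fun _ _ _ => abs_nonneg _
    _ ≤ ∑ r ∈ Icc 1 Rn, ∑ q ∈ Icc 1 Qn, Real.log y * (y * ((q : ℝ) * r)⁻¹ + 1) :=
        Finset.sum_le_sum hinner
    _ = Real.log y * (y * ∑ r ∈ Icc 1 Rn, ∑ q ∈ Icc 1 Qn, ((q : ℝ) * r)⁻¹ + Qn * Rn) := by
        have h1 : ∀ r ∈ Icc 1 Rn, ∑ q ∈ Icc 1 Qn, Real.log y * (y * ((q : ℝ) * r)⁻¹ + 1) =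
            Real.log y * (y * ∑ q ∈ Icc 1 Qn, ((q : ℝ) * r)⁻¹ + Qn) := by
          intro r _
          rw [← Finset.mul_sum, Finset.sum_add_distrib, Finset.mul_sum, Finset.sum_const, Nat.card_Icc,
            Nat.add_sub_cancel, nsmul_eq_mul, mul_one]
        rw [Finset.sum_congr rfl h1, ← Finset.mul_sum, Finset.sum_add_distrib, Finset.mul_sum,
          Finset.sum_const, Nat.card_Icc, Nat.add_sub_cancel, nsmul_eq_mul]
        ring
    _ ≤ Real.log y * (y * ((1 + Real.log Qn) * (1 + Real.log Rn)) + Qn * Rn) := by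
        gcongr
        exact sum_sum_mul_inv_le Qn Rn

/-- `T₃` for pairs: for `|δ| ≤ 1`, `1 ≤ y ≤ x`,
`|∑_{r ≤ Rn, pR} δ_r ∑_{q ≤ Qn, pQ} (φ(qr)⁻¹ ∑_{y<n≤x,(n,qr)=1} Λ(n) − x/φ(qr))|
 ≤ (1 + log Qn)²(1 + log Rn)² (|ψ(x) − x| + ψ(y) + 2 log x · log(Qn Rn))`. [folklore] -/
theorem abs_pairSum_coprime_main_le (Qn Rn : ℕ) (pQ pR : ℕ → Prop) [DecidablePred pQ]
    [DecidablePred pR] {δ : ℕ → ℝ} (hδ : ∀ r, |δ r| ≤ 1) {y x : ℝ} (hy : 1 ≤ y) (hyx : y ≤ x) :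
    |∑ r ∈ (Icc 1 Rn).filter pR, δ r * ∑ q ∈ (Icc 1 Qn).filter pQ,
        ((∑ n ∈ Ioc ⌊y⌋₊ ⌊x⌋₊, if n.Coprime (q * r) then Λ n else 0) / (Nat.totient (q * r) : ℝ) -
          x / (Nat.totient (q * r) : ℝ))| ≤
      (1 + Real.log Qn) ^ 2 * (1 + Real.log Rn) ^ 2 *
        (|ψ x - x| + ψ y + 2 * Real.log x * Real.log ((Qn : ℝ) * Rn)) := by
  have hx1 : 1 ≤ x := hy.trans hyx
  have hlogx : 0 ≤ Real.log x := Real.log_nonneg hx1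
  set B : ℝ := |ψ x - x| + ψ y + 2 * Real.log x * Real.log ((Qn : ℝ) * Rn) with hB
  have hlogQR0 : 0 ≤ Real.log ((Qn : ℝ) * Rn) := by
    rw [← Nat.cast_mul]; exact Real.log_natCast_nonneg _
  have hB0 : 0 ≤ B := by
    have := Chebyshev.psi_nonneg y
    positivity
  -- per pair
  have hpair : ∀ r ∈ Icc 1 Rn, ∀ q ∈ Icc 1 Qn,
      |((∑ n ∈ Ioc ⌊y⌋₊ ⌊x⌋₊, if n.Coprime (q * r) then Λ n else 0) / (Nat.totient (q * r) : ℝ) -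
          x / (Nat.totient (q * r) : ℝ))| ≤ ((Nat.totient (q * r) : ℝ))⁻¹ * B := by
    intro r hr q hq
    have hr1 : 1 ≤ r := (mem_Icc.1 hr).1
    have hq1 : 1 ≤ q := (mem_Icc.1 hq).1
    have hqr1 : 1 ≤ q * r := Nat.mul_pos hq1 hr1
    have hφ : 0 < (Nat.totient (q * r) : ℝ) := by exact_mod_cast Nat.totient_pos.2 hqr1
    rw [← sub_div, abs_div, abs_of_pos hφ, div_eq_inv_mul]
    refine mul_le_mul_of_nonneg_left ?_ (inv_nonneg.2 hφ.le)
    refine (abs_sum_Ioc_coprime_sub_le (q * r) hyx).trans ?_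
    rw [hB]
    gcongr
    refine (nonCoprimePart_le (by omega) (zero_le_one.trans hx1)).trans ?_
    have hqrle : ((q * r : ℕ) : ℝ) ≤ (Qn : ℝ) * Rn := by
      rw [← Nat.cast_mul]
      exact_mod_cast Nat.mul_le_mul (mem_Icc.1 hq).2 (mem_Icc.1 hr).2
    have hlogq : Real.log ((q * r : ℕ) : ℝ) ≤ Real.log ((Qn : ℝ) * Rn) :=
      Real.log_le_log (by exact_mod_cast hqr1) hqrle
    have hlogq0 : 0 ≤ Real.log ((q * r : ℕ) : ℝ) := Real.log_natCast_nonneg _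
    have hfl : (⌊Real.log x / Real.log 2⌋₊ : ℝ) ≤ 2 * Real.log x := by
      refine (Nat.floor_le (div_nonneg hlogx (Real.log_nonneg one_le_two))).trans ?_
      rw [div_le_iff₀ (Real.log_pos one_lt_two)]
      have := Real.log_two_gt_d9
      nlinarith
    calc (⌊Real.log x / Real.log 2⌋₊ : ℝ) * Real.log ((q * r : ℕ) : ℝ)
        ≤ 2 * Real.log x * Real.log ((q * r : ℕ) : ℝ) := mul_le_mul_of_nonneg_right hfl hlogq0
      _ ≤ 2 * Real.log x * Real.log ((Qn : ℝ) * Rn) := by gcongr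
  -- per `r`
  have hinner : ∀ r ∈ Icc 1 Rn, |δ r * ∑ q ∈ (Icc 1 Qn).filter pQ,
      ((∑ n ∈ Ioc ⌊y⌋₊ ⌊x⌋₊, if n.Coprime (q * r) then Λ n else 0) / (Nat.totient (q * r) : ℝ) -
        x / (Nat.totient (q * r) : ℝ))| ≤ ∑ q ∈ Icc 1 Qn, ((Nat.totient (q * r) : ℝ))⁻¹ * B := by
    intro r hr
    rw [abs_mul]
    calc _ ≤ 1 * |∑ q ∈ (Icc 1 Qn).filter pQ,
          ((∑ n ∈ Ioc ⌊y⌋₊ ⌊x⌋₊, if n.Coprime (q * r) then Λ n else 0) / (Nat.totient (q * r) : ℝ) -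
            x / (Nat.totient (q * r) : ℝ))| :=
          mul_le_mul_of_nonneg_right (hδ r) (abs_nonneg _)
      _ ≤ ∑ q ∈ (Icc 1 Qn).filter pQ, ((Nat.totient (q * r) : ℝ))⁻¹ * B := by
          rw [one_mul]
          exact (Finset.abs_sum_le_sum_abs _ _).trans
            (Finset.sum_le_sum fun q hq => hpair r hr q (mem_filter.1 hq).1)
      _ ≤ ∑ q ∈ Icc 1 Qn, ((Nat.totient (q * r) : ℝ))⁻¹ * B :=
          Finset.sum_le_sum_of_subset_of_nonneg (Finset.filter_subset _ _) fun q _ _ => by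
            positivity
  calc _ ≤ ∑ r ∈ (Icc 1 Rn).filter pR, |δ r * ∑ q ∈ (Icc 1 Qn).filter pQ,
          ((∑ n ∈ Ioc ⌊y⌋₊ ⌊x⌋₊, if n.Coprime (q * r) then Λ n else 0) / (Nat.totient (q * r) : ℝ) -
            x / (Nat.totient (q * r) : ℝ))| := Finset.abs_sum_le_sum_abs _ _
    _ ≤ ∑ r ∈ Icc 1 Rn, |δ r * ∑ q ∈ (Icc 1 Qn).filter pQ,
          ((∑ n ∈ Ioc ⌊y⌋₊ ⌊x⌋₊, if n.Coprime (q * r) then Λ n else 0) / (Nat.totient (q * r) : ℝ) -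
            x / (Nat.totient (q * r) : ℝ))| :=
        Finset.sum_le_sum_of_subset_of_nonneg (Finset.filter_subset _ _) fun _ _ _ => abs_nonneg _
    _ ≤ ∑ r ∈ Icc 1 Rn, ∑ q ∈ Icc 1 Qn, ((Nat.totient (q * r) : ℝ))⁻¹ * B := Finset.sum_le_sum hinner
    _ = (∑ r ∈ Icc 1 Rn, ∑ q ∈ Icc 1 Qn, ((Nat.totient (q * r) : ℝ))⁻¹) * B := by
        rw [Finset.sum_mul]
        exact Finset.sum_congr rfl fun r _ => by rw [Finset.sum_mul]
    _ ≤ (1 + Real.log Qn) ^ 2 * (1 + Real.log Rn) ^ 2 * B :=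
        mul_le_mul_of_nonneg_right (sum_sum_totient_mul_inv_le Qn Rn) hB0


/-! ### Real-arithmetic steps of the reduction -/

/-- Arithmetic of `T₁` (pairs): with `yK ≤ x/L^{A+5}`, `Qn Rn ≤ x/L^{A+1}` and all logarithms `≤ L`,
`log yK · (yK (1 + log Qn)(1 + log Rn) + Qn Rn) ≤ 5 x / L^A`. [folklore] -/
theorem reduction9_T1_arith {A L x yK Qn Rn : ℝ} (hL0 : 0 < L) (hL1 : 1 ≤ L) (hx0 : 0 ≤ x)
    (hyK0 : 0 ≤ yK) (hyKup : yK ≤ x / L ^ (A + 5)) (hlogyK : Real.log yK ≤ L)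
    (hQn0 : 0 ≤ Qn) (hRn0 : 0 ≤ Rn)
    (hlogQ : Real.log Qn ≤ L) (hlogQ0 : 0 ≤ Real.log Qn) (hlogR : Real.log Rn ≤ L)
    (hlogR0 : 0 ≤ Real.log Rn) (hQR : Qn * Rn ≤ x / L ^ (A + 1)) :
    Real.log yK * (yK * ((1 + Real.log Qn) * (1 + Real.log Rn)) + Qn * Rn) ≤ 5 * x / L ^ A := by
  have hLA0 : 0 < L ^ A := Real.rpow_pos_of_pos hL0 A
  have hLA1 : L ^ (A + 1) = L ^ A * L := by rw [Real.rpow_add hL0, Real.rpow_one]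
  have hLA5 : L ^ (A + 5) = L ^ A * L ^ 5 := by
    rw [Real.rpow_add hL0, show (5 : ℝ) = ((5 : ℕ) : ℝ) by norm_num, Real.rpow_natCast]
  have h1 : (1 + Real.log Qn) * (1 + Real.log Rn) ≤ 4 * L ^ 2 := by nlinarith
  have h2 : Real.log yK * (yK * ((1 + Real.log Qn) * (1 + Real.log Rn)) + Qn * Rn) ≤
      L * (yK * (4 * L ^ 2) + Qn * Rn) := by
    have h3 : yK * ((1 + Real.log Qn) * (1 + Real.log Rn)) ≤ yK * (4 * L ^ 2) :=
      mul_le_mul_of_nonneg_left h1 hyK0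
    calc _ ≤ L * (yK * ((1 + Real.log Qn) * (1 + Real.log Rn)) + Qn * Rn) :=
          mul_le_mul_of_nonneg_right hlogyK (by positivity)
      _ ≤ L * (yK * (4 * L ^ 2) + Qn * Rn) := by gcongr
  refine h2.trans ?_
  have h4 : L * (yK * (4 * L ^ 2)) ≤ 4 * x / L ^ A := by
    have hy' : yK ≤ x / (L ^ A * L ^ 5) := by rw [← hLA5]; exact hyKup
    have hL35 : L ^ 3 ≤ L ^ 5 := pow_le_pow_right₀ hL1 (by norm_num)
    calc L * (yK * (4 * L ^ 2)) = 4 * L ^ 3 * yK := by ring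
      _ ≤ 4 * L ^ 3 * (x / (L ^ A * L ^ 5)) := by gcongr
      _ = 4 * x / L ^ A * (L ^ 3 / L ^ 5) := by field_simp
      _ ≤ 4 * x / L ^ A * 1 := by
          refine mul_le_mul_of_nonneg_left ?_ (by positivity)
          rwa [div_le_one (by positivity)]
      _ = 4 * x / L ^ A := mul_one _
  have h5 : L * (Qn * Rn) ≤ x / L ^ A := by
    calc L * (Qn * Rn) ≤ L * (x / L ^ (A + 1)) := mul_le_mul_of_nonneg_left hQR hL0.le
      _ = x / L ^ A := by rw [hLA1]; field_simp
  calc L * (yK * (4 * L ^ 2) + Qn * Rn) = L * (yK * (4 * L ^ 2)) + L * (Qn * Rn) := by ring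
    _ ≤ 4 * x / L ^ A + x / L ^ A := add_le_add h4 h5
    _ = 5 * x / L ^ A := by ring

/-- Arithmetic of `T₃` (pairs): with `|ψ(x) − x| ≤ C x/L^{A+6}`, `ψ(yK) ≤ 7x/L^{A+5}`, logarithms `≤ L`
and `32 L^{A+6} ≤ x`:
`(1 + log Qn)² (1 + log Rn)² (|ψ(x) − x| + ψ(yK) + 2 L log(Qn Rn)) ≤ (16C + 113) x / L^A`. [folklore] -/
theorem reduction9_T3_arith {A L x yK Qn Rn C : ℝ} (hL0 : 0 < L) (hL1 : 1 ≤ L) (hx0 : 0 ≤ x)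
    (hC : 0 ≤ C)
    (hψx : |ψ x - x| ≤ C * x / L ^ (A + 6)) (hψyK : ψ yK ≤ 7 * (x / L ^ (A + 5)))
    (hlogQ : Real.log Qn ≤ L) (hlogQ0 : 0 ≤ Real.log Qn) (hlogR : Real.log Rn ≤ L)
    (hlogR0 : 0 ≤ Real.log Rn) (hlogQR : Real.log (Qn * Rn) ≤ L) (hlogQR0 : 0 ≤ Real.log (Qn * Rn))
    (he5 : 32 * L ^ (A + 6) ≤ x) :
    (1 + Real.log Qn) ^ 2 * (1 + Real.log Rn) ^ 2 * (|ψ x - x| + ψ yK + 2 * L * Real.log (Qn * Rn)) ≤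
      (16 * C + 113) * x / L ^ A := by
  have hLA0 : 0 < L ^ A := Real.rpow_pos_of_pos hL0 A
  have hLA5 : L ^ (A + 5) = L ^ A * L ^ 5 := by
    rw [Real.rpow_add hL0, show (5 : ℝ) = ((5 : ℕ) : ℝ) by norm_num, Real.rpow_natCast]
  have hLA6 : L ^ (A + 6) = L ^ A * L ^ 6 := by
    rw [Real.rpow_add hL0, show (6 : ℝ) = ((6 : ℕ) : ℝ) by norm_num, Real.rpow_natCast]
  have hsq : (1 + Real.log Qn) ^ 2 * (1 + Real.log Rn) ^ 2 ≤ 16 * L ^ 4 := by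
    have h1 : (1 + Real.log Qn) ^ 2 ≤ 4 * L ^ 2 := by nlinarith
    have h2 : (1 + Real.log Rn) ^ 2 ≤ 4 * L ^ 2 := by nlinarith
    calc _ ≤ (4 * L ^ 2) * (4 * L ^ 2) := mul_le_mul h1 h2 (by positivity) (by positivity)
      _ = 16 * L ^ 4 := by ring
  have hB : |ψ x - x| + ψ yK + 2 * L * Real.log (Qn * Rn) ≤
      C * x / L ^ (A + 6) + 7 * (x / L ^ (A + 5)) + 2 * L ^ 2 := by
    have : 2 * L * Real.log (Qn * Rn) ≤ 2 * L ^ 2 := by nlinarith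
    linarith
  have hB0 : 0 ≤ |ψ x - x| + ψ yK + 2 * L * Real.log (Qn * Rn) := by
    have := Chebyshev.psi_nonneg yK
    positivity
  calc (1 + Real.log Qn) ^ 2 * (1 + Real.log Rn) ^ 2 * (|ψ x - x| + ψ yK + 2 * L * Real.log (Qn * Rn))
      ≤ 16 * L ^ 4 * (C * x / L ^ (A + 6) + 7 * (x / L ^ (A + 5)) + 2 * L ^ 2) :=
        mul_le_mul hsq hB hB0 (by positivity)
    _ = 16 * C * x / L ^ A * (L ^ 4 / L ^ 6) + 112 * x / L ^ A * (L ^ 4 / L ^ 5) + 32 * L ^ 6 := by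
        rw [hLA5, hLA6]; field_simp; ring
    _ ≤ 16 * C * x / L ^ A * (L ^ 4 / L ^ 6) + 112 * x / L ^ A * 1 + x / L ^ A := by
        have hL45 : L ^ 4 ≤ L ^ 5 := pow_le_pow_right₀ hL1 (by norm_num)
        refine add_le_add (add_le_add le_rfl (mul_le_mul_of_nonneg_left ?_ (by positivity))) ?_
        · rwa [div_le_one (by positivity)]
        · rw [le_div_iff₀ hLA0]
          calc 32 * L ^ 6 * L ^ A = 32 * L ^ (A + 6) := by rw [hLA6]; ring
            _ ≤ x := he5
    _ ≤ 16 * C * x / L ^ A * 1 + 112 * x / L ^ A * 1 + x / L ^ A := by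
        have hL46 : L ^ 4 / L ^ 6 ≤ 1 := by
          rw [div_le_one (by positivity)]; exact pow_le_pow_right₀ hL1 (by norm_num)
        refine add_le_add (add_le_add ?_ le_rfl) le_rfl
        exact mul_le_mul_of_nonneg_left hL46 (by positivity)
    _ = (16 * C + 113) * x / L ^ A := by ring


/-- The eventual inequalities in `x` used in the reduction for pairs. [folklore] -/
theorem eventually_reduction_bounds9 (x₁ A : ℝ) {ε : ℝ} (hε : 0 < ε) :
    ∀ᶠ x : ℝ in atTop, 3 ≤ x ∧ 8 ≤ Real.log x ∧
      4 * max x₁ 2 * Real.log x ^ (A + 5) ≤ x ∧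
      (2 * Real.log x ^ (A + 5)) ^ 2 ≤ x ∧
      2 * Real.log x ^ (A + 5) ≤ x ^ (ε / 2) ∧
      32 * Real.log x ^ (A + 6) ≤ x := by
  filter_upwards [eventually_ge_atTop (3 : ℝ), Real.tendsto_log_atTop.eventually_ge_atTop 8,
    Real.tendsto_log_atTop.eventually_ge_atTop (4 * max x₁ 2),
    Real.tendsto_log_atTop.eventually_ge_atTop 32,
    Literature.NumberTheory.Sieve.eventually_log_rpow_le_rpow (A + 6) one_pos,
    Literature.NumberTheory.Sieve.eventually_log_rpow_le_rpow (2 * A + 11) one_pos,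
    Literature.NumberTheory.Sieve.eventually_log_rpow_le_rpow (A + 6) (half_pos hε),
    Literature.NumberTheory.Sieve.eventually_log_rpow_le_rpow (A + 7) one_pos] with x hx3 hL8 hLx₁ hL32 h1 h2 h3
      h5
  have hL0 : 0 < Real.log x := by linarith
  have hx1 : x ^ (1 : ℝ) = x := Real.rpow_one x
  have hsplit : ∀ r : ℝ, Real.log x ^ (r + 1) = Real.log x ^ r * Real.log x := fun r => by
    rw [Real.rpow_add hL0, Real.rpow_one]
  refine ⟨hx3, hL8, ?_, ?_, ?_, ?_⟩
  · rw [hx1] at h1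
    calc 4 * max x₁ 2 * Real.log x ^ (A + 5) ≤ Real.log x * Real.log x ^ (A + 5) :=
          mul_le_mul_of_nonneg_right hLx₁ (by positivity)
      _ = Real.log x ^ (A + 6) := by rw [show A + 6 = (A + 5) + 1 by ring, hsplit]; ring
      _ ≤ x := h1
  · rw [hx1] at h2
    calc (2 * Real.log x ^ (A + 5)) ^ 2 = 4 * (Real.log x ^ (A + 5) * Real.log x ^ (A + 5)) := by
          ring
      _ = 4 * Real.log x ^ (2 * A + 10) := by rw [← Real.rpow_add hL0]; ring_nf
      _ ≤ Real.log x * Real.log x ^ (2 * A + 10) :=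
          mul_le_mul_of_nonneg_right (by linarith) (by positivity)
      _ = Real.log x ^ (2 * A + 11) := by
          rw [show 2 * A + 11 = (2 * A + 10) + 1 by ring, hsplit]; ring
      _ ≤ x := h2
  · calc 2 * Real.log x ^ (A + 5) ≤ Real.log x * Real.log x ^ (A + 5) :=
          mul_le_mul_of_nonneg_right (by linarith) (by positivity)
      _ = Real.log x ^ (A + 6) := by rw [show A + 6 = (A + 5) + 1 by ring, hsplit]; ring
      _ ≤ x ^ (ε / 2) := h3
  · rw [hx1] at h5
    calc 32 * Real.log x ^ (A + 6) ≤ Real.log x * Real.log x ^ (A + 6) :=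
          mul_le_mul_of_nonneg_right hL32 (by positivity)
      _ = Real.log x ^ (A + 7) := by rw [show A + 7 = (A + 6) + 1 by ring, hsplit]; ring
      _ ≤ x := h5

end BFI

open BFI

/-! ### Theorem 9 (signed form) from its dyadic form -/

set_option maxHeartbeats 800000 in -- one long assembly (`T₁ + T₂ + T₃`) with ~60 hypotheses
/-- **The signed form of Theorem 9 from its dyadic form** (the "trivial observation" opening §15
of the source, p. 244, for the weights `γ_q = 1_{q ≤ Q, (q,a)=1}`, `δ_r 1_{r ≤ R, (r,a)=1}` of §16):
if for every `ε > 0`, `A > 0` there are `B, C, x₀` with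
`|∑_{r ≤ R, (r,a)=1} δ_r ∑_{q ≤ Q, (q,a)=1} E(x; qr, a)| ≤ C x ℒ^{−A}` for `x ≥ x₀`, `R < x^{1/10−ε}`,
`QR < x ℒ^{−B}`, `|δ| ≤ 1` (`E` the balanced dyadic discrepancy `BFI.dyadDisc`), then the same holds
with `E(x; qr, a)` replaced by `ψ(x; qr, a) − x/φ(qr)` — by the decomposition `T₁ + T₂ + T₃` of
`BombieriFriedlanderIwaniecTheorem10_of_dyadic` (dyadic depth `2^K ≍ ℒ^{A+5}`, the prime number
theorem with the de la Vallée Poussin error term for `T₃`, `∑_{q,r} 1/φ(qr) ≤ (1 + log Q)²(1 + log R)²`).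
[cite: BombieriFriedlanderIwaniecActa1986, §15 (15.1) p. 244; §16 p. 250] -/
theorem BFI.thm9Signed_of_dyadic {a : ℤ}
    (hdy : ∀ ε : ℝ, 0 < ε → ∀ A : ℝ, 0 < A → ∃ B C x₀ : ℝ, ∀ x : ℝ, x₀ ≤ x → ∀ Q R : ℝ,
      R < x ^ (1 / 10 - ε) → Q * R < x / Real.log x ^ B → ∀ δ : ℕ → ℝ, (∀ r, |δ r| ≤ 1) →
        |∑ r ∈ (Icc 1 ⌊R⌋₊).filter (fun r : ℕ => IsCoprime (r : ℤ) a),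
            δ r * ∑ q ∈ (Icc 1 ⌊Q⌋₊).filter (fun q : ℕ => IsCoprime (q : ℤ) a),
              dyadDisc (q * r) a x| ≤ C * x / Real.log x ^ A)
    {ε : ℝ} (hε : 0 < ε) {A : ℝ} (hA : 0 < A) :
    ∃ B C x₀ : ℝ, ∀ x : ℝ, x₀ ≤ x → ∀ Q R : ℝ,
      R < x ^ (1 / 10 - ε) → Q * R < x / Real.log x ^ B → ∀ δ : ℕ → ℝ, (∀ r, |δ r| ≤ 1) →
        |∑ r ∈ (Icc 1 ⌊R⌋₊).filter (fun r : ℕ => IsCoprime (r : ℤ) a),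
            δ r * ∑ q ∈ (Icc 1 ⌊Q⌋₊).filter (fun q : ℕ => IsCoprime (q : ℤ) a),
              (LevelOfDistribution.chebyshevPsiMod (q * r) (a : ZMod (q * r)) x -
                x / (Nat.totient (q * r) : ℝ))| ≤
          C * x / Real.log x ^ A := by
  -- Case `ε ≥ 1/10`: there are no moduli `1 ≤ r ≤ R < x^{1/10−ε} ≤ 1`.
  by_cases hε10 : 1 / 10 ≤ ε
  · refine ⟨0, 0, 1, fun x hx Q R hR _ δ _ => ?_⟩
    have hR1 : R < 1 := hR.trans_le (Real.rpow_le_one_of_one_le_of_nonpos hx (by linarith))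
    have hR : ⌊R⌋₊ = 0 := Nat.floor_eq_zero.2 (by linarith)
    rw [hR]
    simp
  push Not at hε10
  -- Main case `ε < 1/10`.
  obtain ⟨B₁, C₁, x₁, hC₁⟩ := hdy (ε / 2) (half_pos hε) (A + 2) (by linarith)
  obtain ⟨CP, hCP⟩ := LFunctions.ChebyshevPsiDeLaValleePoussin_holds.logPow (A + 6)
  set B₁' : ℝ := max B₁ 0 with hB₁'
  set C₁' : ℝ := max C₁ 0 with hC₁'
  set CP' : ℝ := max CP 0 with hCP'
  have hB₁'0 : 0 ≤ B₁' := le_max_right _ _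
  have hC₁'0 : 0 ≤ C₁' := le_max_right _ _
  have hCP'0 : 0 ≤ CP' := le_max_right _ _
  obtain ⟨x₀, hx₀⟩ := Filter.eventually_atTop.1 (eventually_reduction_bounds9 x₁ A hε)
  refine ⟨A + 6 + B₁', 5 + C₁' * 2 ^ (A + 2) + (16 * CP' + 113), x₀, fun x hx Q R hR hQR δ hδ => ?_⟩
  obtain ⟨hx3, hL8, he1, he2, he3, he5⟩ := hx₀ x hx
  -- notation
  set L : ℝ := Real.log x with hL
  set c : ℝ := 1 / 10 - ε with hc
  have hx1 : (1 : ℝ) ≤ x := by linarith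
  have hx0 : (0 : ℝ) ≤ x := by linarith
  have hxpos : (0 : ℝ) < x := by linarith
  have hL0 : 0 < L := by linarith
  have hL1 : 1 ≤ L := by linarith
  have hLA0 : 0 < L ^ A := Real.rpow_pos_of_pos hL0 A
  have hc0 : 0 < c := by rw [hc]; linarith
  have hc1 : c ≤ 1 := by rw [hc]; linarith
  have hRHS0 : 0 ≤ (5 + C₁' * 2 ^ (A + 2) + (16 * CP' + 113)) * x / Real.log x ^ A := by
    rw [← hL]; positivity
  -- degenerate ranges: no `r` or no `q`
  by_cases hR1 : R < 1
  · have : ⌊R⌋₊ = 0 := Nat.floor_eq_zero.2 (by linarith)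
    rw [this]; simpa using hRHS0
  by_cases hQ1 : Q < 1
  · have : ⌊Q⌋₊ = 0 := Nat.floor_eq_zero.2 (by linarith)
    rw [this]; simpa using hRHS0
  push Not at hR1 hQ1
  set SR : Finset ℕ := (Icc 1 ⌊R⌋₊).filter (fun r : ℕ => IsCoprime (r : ℤ) a) with hSR
  set SQ : Finset ℕ := (Icc 1 ⌊Q⌋₊).filter (fun q : ℕ => IsCoprime (q : ℤ) a) with hSQ
  -- sizes of `Q`, `R`
  have hLB : L ^ A ≤ L ^ (A + 6 + B₁') := Real.rpow_le_rpow_of_exponent_le hL1 (by linarith)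
  have hLB0 : 0 < L ^ (A + 6 + B₁') := Real.rpow_pos_of_pos hL0 _
  have hQRx : Q * R < x := by
    refine hQR.trans_le ?_
    rw [div_le_iff₀ hLB0]
    have : 1 ≤ L ^ (A + 6 + B₁') := Real.one_le_rpow hL1 (by linarith)
    nlinarith
  have hQx : Q ≤ x := by nlinarith
  have hRx : R ≤ x := by
    refine hR.le.trans ?_
    calc x ^ c ≤ x ^ (1 : ℝ) := Real.rpow_le_rpow_of_exponent_le hx1 hc1
      _ = x := Real.rpow_one x
  have hQn0 : (0 : ℝ) ≤ ⌊Q⌋₊ := Nat.cast_nonneg _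
  have hRn0 : (0 : ℝ) ≤ ⌊R⌋₊ := Nat.cast_nonneg _
  have hQnQ : (⌊Q⌋₊ : ℝ) ≤ Q := Nat.floor_le (by linarith)
  have hRnR : (⌊R⌋₊ : ℝ) ≤ R := Nat.floor_le (by linarith)
  have hQn1 : (1 : ℝ) ≤ ⌊Q⌋₊ := by exact_mod_cast Nat.le_floor (by simpa using hQ1)
  have hRn1 : (1 : ℝ) ≤ ⌊R⌋₊ := by exact_mod_cast Nat.le_floor (by simpa using hR1)
  have hlogQn : Real.log ⌊Q⌋₊ ≤ L := Real.log_le_log (by linarith) (hQnQ.trans hQx)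
  have hlogRn : Real.log ⌊R⌋₊ ≤ L := Real.log_le_log (by linarith) (hRnR.trans hRx)
  have hlogQn0 : 0 ≤ Real.log ⌊Q⌋₊ := Real.log_natCast_nonneg _
  have hlogRn0 : 0 ≤ Real.log ⌊R⌋₊ := Real.log_natCast_nonneg _
  have hQRn : (⌊Q⌋₊ : ℝ) * ⌊R⌋₊ ≤ Q * R := mul_le_mul hQnQ hRnR hRn0 (by linarith)
  have hlogQRn : Real.log ((⌊Q⌋₊ : ℝ) * ⌊R⌋₊) ≤ L :=
    Real.log_le_log (by positivity) (hQRn.trans hQRx.le)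
  have hlogQRn0 : 0 ≤ Real.log ((⌊Q⌋₊ : ℝ) * ⌊R⌋₊) := Real.log_nonneg (by nlinarith)
  -- the dyadic depth `K` with `L^{A+5} < 2^K ≤ 2 L^{A+5}`
  have hLA : 1 ≤ L ^ (A + 5) := Real.one_le_rpow hL1 (by linarith)
  obtain ⟨K, hPlow, hPup⟩ := exists_pow_two_near hLA
  have hP0 : (0 : ℝ) < 2 ^ K := by positivity
  set yK : ℝ := x / 2 ^ K with hyK
  set m : ℝ := x / (2 * L ^ (A + 5)) with hm
  have hm0 : 0 < 2 * L ^ (A + 5) := by positivity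
  have hmyK : m ≤ yK := div_le_div_of_nonneg_left hx0 hP0 hPup
  have hyKup : yK ≤ x / L ^ (A + 5) := div_le_div_of_nonneg_left hx0 (by positivity) hPlow.le
  have hyKx : yK ≤ x := div_le_self hx0 (one_le_pow₀ one_le_two)
  have hm_ge : max x₁ 2 ≤ m := by rw [hm, le_div_iff₀ hm0]; linarith
  have hm2 : 2 ≤ m := (le_max_right _ _).trans hm_ge
  have hmpos : 0 < m := by linarith
  have hm_sqrt : Real.sqrt x ≤ m := by
    rw [hm, le_div_iff₀ hm0]
    calc Real.sqrt x * (2 * L ^ (A + 5)) ≤ Real.sqrt x * Real.sqrt x := by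
          refine mul_le_mul_of_nonneg_left ?_ (Real.sqrt_nonneg x)
          rw [Real.le_sqrt (by positivity) hx0]; exact he2
      _ = x := Real.mul_self_sqrt hx0
  have hlogm : L / 2 ≤ Real.log m := by
    have : Real.log (Real.sqrt x) = L / 2 := by rw [hL, Real.log_sqrt hx0]
    rw [← this]
    exact Real.log_le_log (Real.sqrt_pos.2 hxpos) hm_sqrt
  have hlogm1 : 1 ≤ Real.log m := by linarith
  -- level comparison: `x^{1/10−ε} ≤ m^{1/10−ε/2}`
  have hlevm : x ^ c ≤ m ^ (1 / 10 - ε / 2) := by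
    have hce : 1 / 10 - ε / 2 = c + ε / 2 := by rw [hc]; ring
    rw [hce, hm, Real.div_rpow hx0 hm0.le, le_div_iff₀ (Real.rpow_pos_of_pos hm0 _),
      Real.rpow_add hxpos]
    refine mul_le_mul_of_nonneg_left ?_ (by positivity)
    have hbase : 1 ≤ 2 * L ^ (A + 5) := by linarith
    calc (2 * L ^ (A + 5)) ^ (c + ε / 2) ≤ (2 * L ^ (A + 5)) ^ (1 : ℝ) :=
          Real.rpow_le_rpow_of_exponent_le hbase (by rw [hc]; linarith)
      _ = 2 * L ^ (A + 5) := Real.rpow_one _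
      _ ≤ x ^ (ε / 2) := he3
  -- the level of the moduli against `m`: `x / L^{A+6+B₁'} ≤ m / L^{B₁'}`
  have hlevQR : x / L ^ (A + 6 + B₁') ≤ m / L ^ B₁' := by
    have hkey : 2 * L ^ (A + 5) * L ^ B₁' ≤ L ^ (A + 6 + B₁') := by
      have h1 : L ^ (A + 6 + B₁') = L * L ^ (A + 5) * L ^ B₁' := by
        rw [show A + 6 + B₁' = 1 + (A + 5) + B₁' by ring, Real.rpow_add hL0, Real.rpow_add hL0,
          Real.rpow_one]
      rw [h1]
      exact mul_le_mul_of_nonneg_right (mul_le_mul_of_nonneg_right (by linarith) (by positivity))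
        (by positivity)
    calc x / L ^ (A + 6 + B₁') ≤ x / (2 * L ^ (A + 5) * L ^ B₁') :=
          div_le_div_of_nonneg_left hx0 (by positivity) hkey
      _ = m / L ^ B₁' := by rw [hm, div_div]
  -- basic facts on `yK`
  have hyK1 : 1 ≤ yK := by linarith
  have hyK0 : 0 ≤ yK := by linarith
  have hlogyK : Real.log yK ≤ L := Real.log_le_log (by linarith) hyKx
  -- Step A: the decomposition `T₁ + T₂ + T₃`, modulus by modulus
  have hdecomp : ∀ d : ℕ,
      LevelOfDistribution.chebyshevPsiMod d (a : ZMod d) x - x / (Nat.totient d : ℝ) =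
      LevelOfDistribution.chebyshevPsiMod d (a : ZMod d) (x / 2 ^ K) +
        (∑ k ∈ range K, dyadDisc d a (x / 2 ^ (k + 1))) +
        ((∑ n ∈ Ioc ⌊x / 2 ^ K⌋₊ ⌊x⌋₊, if n.Coprime d then Λ n else 0) / (Nat.totient d : ℝ) -
          x / (Nat.totient d : ℝ)) := by
    intro d
    have hdisc : ∀ y : ℝ, psiDyadMod d (a : ZMod d) y =
        dyadDisc d a y + psiDyadCoprime d y / (Nat.totient d : ℝ) := fun y => by
      unfold dyadDisc; ring
    rw [chebyshevPsiMod_eq_add_sum_psiDyadMod d _ hx0 K,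
      Finset.sum_congr rfl fun k _ => hdisc (x / 2 ^ (k + 1)), Finset.sum_add_distrib,
      ← Finset.sum_div, sum_psiDyadCoprime_eq d hx0 K]
    ring
  have hinner : ∀ r : ℕ, ∑ q ∈ SQ,
      (LevelOfDistribution.chebyshevPsiMod (q * r) (a : ZMod (q * r)) x - x / (Nat.totient (q * r) : ℝ)) =
      (∑ q ∈ SQ, LevelOfDistribution.chebyshevPsiMod (q * r) (a : ZMod (q * r)) yK) +
        (∑ k ∈ range K, ∑ q ∈ SQ, dyadDisc (q * r) a (x / 2 ^ (k + 1))) +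
        ∑ q ∈ SQ, ((∑ n ∈ Ioc ⌊yK⌋₊ ⌊x⌋₊, if n.Coprime (q * r) then Λ n else 0) /
          (Nat.totient (q * r) : ℝ) - x / (Nat.totient (q * r) : ℝ)) := by
    intro r
    rw [Finset.sum_congr rfl fun q _ => hdecomp (q * r), Finset.sum_add_distrib,
      Finset.sum_add_distrib, Finset.sum_comm]
  have htotal : ∑ r ∈ SR, δ r * ∑ q ∈ SQ,
      (LevelOfDistribution.chebyshevPsiMod (q * r) (a : ZMod (q * r)) x - x / (Nat.totient (q * r) : ℝ)) =
      (∑ r ∈ SR, δ r * ∑ q ∈ SQ, LevelOfDistribution.chebyshevPsiMod (q * r) (a : ZMod (q * r)) yK) +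
        (∑ k ∈ range K, ∑ r ∈ SR, δ r * ∑ q ∈ SQ, dyadDisc (q * r) a (x / 2 ^ (k + 1))) +
        ∑ r ∈ SR, δ r * ∑ q ∈ SQ, ((∑ n ∈ Ioc ⌊yK⌋₊ ⌊x⌋₊, if n.Coprime (q * r) then Λ n else 0) /
          (Nat.totient (q * r) : ℝ) - x / (Nat.totient (q * r) : ℝ)) := by
    have h1 : ∀ r ∈ SR, δ r * ∑ q ∈ SQ,
        (LevelOfDistribution.chebyshevPsiMod (q * r) (a : ZMod (q * r)) x - x / (Nat.totient (q * r) : ℝ)) =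
        δ r * (∑ q ∈ SQ, LevelOfDistribution.chebyshevPsiMod (q * r) (a : ZMod (q * r)) yK) +
          (∑ k ∈ range K, δ r * ∑ q ∈ SQ, dyadDisc (q * r) a (x / 2 ^ (k + 1))) +
          δ r * ∑ q ∈ SQ, ((∑ n ∈ Ioc ⌊yK⌋₊ ⌊x⌋₊, if n.Coprime (q * r) then Λ n else 0) /
            (Nat.totient (q * r) : ℝ) - x / (Nat.totient (q * r) : ℝ)) := by
      intro r _
      rw [hinner r, mul_add, mul_add, Finset.mul_sum (s := range K)]
    rw [Finset.sum_congr rfl h1, Finset.sum_add_distrib, Finset.sum_add_distrib,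
      Finset.sum_comm (s := SR) (t := range K)]
  -- Step B: `T₁ ≤ 5 x / L^A`
  have hT1 : |∑ r ∈ SR, δ r * ∑ q ∈ SQ, LevelOfDistribution.chebyshevPsiMod (q * r) (a : ZMod (q * r)) yK| ≤
      5 * x / L ^ A := by
    refine (abs_pairSum_chebyshevPsiMod_le ⌊Q⌋₊ ⌊R⌋₊ (fun q : ℕ => IsCoprime (q : ℤ) a)
      (fun r : ℕ => IsCoprime (r : ℤ) a) hδ a hyK1).trans ?_
    refine reduction9_T1_arith hL0 hL1 hx0 hyK0 hyKup hlogyK hQn0 hRn0 hlogQn hlogQn0 hlogRn hlogRn0 ?_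
    -- `⌊Q⌋⌊R⌋ ≤ QR < x/L^{A+6+B₁'} ≤ x/L^{A+1}`
    refine hQRn.trans (hQR.le.trans ?_)
    exact div_le_div_of_nonneg_left hx0 (Real.rpow_pos_of_pos hL0 _)
      (Real.rpow_le_rpow_of_exponent_le hL1 (by linarith))
  -- Step B: `T₂ ≤ C₁' 2^{A+2} x / L^A`
  have hT2 : ∑ k ∈ range K, |∑ r ∈ SR, δ r * ∑ q ∈ SQ, dyadDisc (q * r) a (x / 2 ^ (k + 1))| ≤
      C₁' * 2 ^ (A + 2) * x / L ^ A := by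
    have hpiece : ∀ k ∈ range K, |∑ r ∈ SR, δ r * ∑ q ∈ SQ, dyadDisc (q * r) a (x / 2 ^ (k + 1))| ≤
        C₁' * 2 ^ (A + 2) * (x / 2 ^ (k + 1)) / L ^ (A + 2) := by
      intro k hk
      have hkK : k + 1 ≤ K := mem_range.1 hk
      set y : ℝ := x / 2 ^ (k + 1) with hy
      have hyKy : yK ≤ y :=
        div_le_div_of_nonneg_left hx0 (by positivity) (pow_le_pow_right₀ one_le_two hkK)
      have hmy : m ≤ y := hmyK.trans hyKy
      have hypos : 0 < y := hmpos.trans_le hmy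
      have hx₁y : x₁ ≤ y := (le_max_left _ _).trans (hm_ge.trans hmy)
      have hlogy1 : 1 ≤ Real.log y := hlogm1.trans (Real.log_le_log hmpos hmy)
      have hlogy0 : 0 < Real.log y := by linarith
      have hyx' : y ≤ x := div_le_self hx0 (one_le_pow₀ one_le_two)
      have hlogyL : Real.log y ≤ L := Real.log_le_log hypos hyx'
      have hlog : L / 2 ≤ Real.log y := hlogm.trans (Real.log_le_log hmpos hmy)
      -- the ranges at `y`
      have hRy : R < y ^ (1 / 10 - ε / 2) :=
        hR.trans_le (hlevm.trans (Real.rpow_le_rpow hmpos.le hmy (by linarith)))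
      have hQRy : Q * R < y / Real.log y ^ B₁ := by
        refine hQR.trans_le (hlevQR.trans ?_)
        calc m / L ^ B₁' ≤ y / L ^ B₁' := div_le_div_of_nonneg_right hmy (Real.rpow_nonneg hL0.le _)
          _ ≤ y / Real.log y ^ B₁' :=
              div_le_div_of_nonneg_left hypos.le (Real.rpow_pos_of_pos hlogy0 _)
                (Real.rpow_le_rpow hlogy0.le hlogyL hB₁'0)
          _ ≤ y / Real.log y ^ B₁ :=
              div_le_div_of_nonneg_left hypos.le (Real.rpow_pos_of_pos hlogy0 _)
                (Real.rpow_le_rpow_of_exponent_le hlogy1 (le_max_left _ _))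
      refine (hC₁ y hx₁y Q R hRy hQRy δ hδ).trans ?_
      have hpow : L ^ (A + 2) / 2 ^ (A + 2) ≤ Real.log y ^ (A + 2) := by
        rw [← Real.div_rpow hL0.le zero_le_two]
        exact Real.rpow_le_rpow (by positivity) hlog (by linarith)
      have hpos : 0 < L ^ (A + 2) / 2 ^ (A + 2) := by positivity
      have h0 : 0 ≤ y / Real.log y ^ (A + 2) := by positivity
      calc C₁ * y / Real.log y ^ (A + 2) = C₁ * (y / Real.log y ^ (A + 2)) := by ring
        _ ≤ C₁' * (y / Real.log y ^ (A + 2)) := mul_le_mul_of_nonneg_right (le_max_left _ _) h0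
        _ = C₁' * y / Real.log y ^ (A + 2) := by ring
        _ ≤ C₁' * y / (L ^ (A + 2) / 2 ^ (A + 2)) :=
            div_le_div_of_nonneg_left (by positivity) hpos hpow
        _ = C₁' * 2 ^ (A + 2) * y / L ^ (A + 2) := by field_simp
        _ = C₁' * 2 ^ (A + 2) * (x / 2 ^ (k + 1)) / L ^ (A + 2) := by rw [hy]
    refine (Finset.sum_le_sum hpiece).trans ?_
    have hsum : ∑ k ∈ range K, C₁' * 2 ^ (A + 2) * (x / 2 ^ (k + 1)) / L ^ (A + 2) =
        C₁' * 2 ^ (A + 2) / L ^ (A + 2) * (x * (1 - 1 / 2 ^ K)) := by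
      rw [← sum_range_div_two_pow_succ, Finset.mul_sum]
      refine Finset.sum_congr rfl fun k _ => ?_
      ring
    rw [hsum]
    exact reduction_T2_arith K hL0 hL1 hx0 hC₁'0
  -- Step B: `T₃ ≤ (16 CP' + 113) x / L^A`
  have hT3 : |∑ r ∈ SR, δ r * ∑ q ∈ SQ, ((∑ n ∈ Ioc ⌊yK⌋₊ ⌊x⌋₊, if n.Coprime (q * r) then Λ n else 0) /
        (Nat.totient (q * r) : ℝ) - x / (Nat.totient (q * r) : ℝ))| ≤ (16 * CP' + 113) * x / L ^ A := by
    refine (abs_pairSum_coprime_main_le ⌊Q⌋₊ ⌊R⌋₊ (fun q : ℕ => IsCoprime (q : ℤ) a)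
      (fun r : ℕ => IsCoprime (r : ℤ) a) hδ hyK1 hyKx).trans ?_
    have hψx : |ψ x - x| ≤ CP' * x / L ^ (A + 6) := by
      refine (hCP x (by linarith)).trans ?_
      have h0 : 0 ≤ x / L ^ (A + 6) := by positivity
      calc CP * x / Real.log x ^ (A + 6) = CP * (x / L ^ (A + 6)) := by rw [hL]; ring
        _ ≤ CP' * (x / L ^ (A + 6)) := mul_le_mul_of_nonneg_right (le_max_left _ _) h0
        _ = CP' * x / L ^ (A + 6) := by ring
    have hψyK : ψ yK ≤ 7 * (x / L ^ (A + 5)) := by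
      refine (Chebyshev.psi_le_const_mul_self hyK0).trans ?_
      have hlog4 : Real.log 4 ≤ 3 := by
        have := Real.log_le_sub_one_of_pos (by norm_num : (0 : ℝ) < 4); linarith
      calc (Real.log 4 + 4) * yK ≤ 7 * yK := mul_le_mul_of_nonneg_right (by linarith) hyK0
        _ ≤ 7 * (x / L ^ (A + 5)) := by gcongr
    exact reduction9_T3_arith hL0 hL1 hx0 hCP'0 hψx hψyK hlogQn hlogQn0 hlogRn hlogRn0
      hlogQRn hlogQRn0 he5
  -- conclusion
  have habs : |∑ r ∈ SR, δ r * ∑ q ∈ SQ,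
      (LevelOfDistribution.chebyshevPsiMod (q * r) (a : ZMod (q * r)) x - x / (Nat.totient (q * r) : ℝ))| ≤
      5 * x / L ^ A + C₁' * 2 ^ (A + 2) * x / L ^ A + (16 * CP' + 113) * x / L ^ A := by
    rw [htotal]
    refine (abs_add_le _ _).trans (add_le_add ((abs_add_le _ _).trans (add_le_add hT1 ?_)) hT3)
    exact (Finset.abs_sum_le_sum_abs _ _).trans hT2
  refine habs.trans (le_of_eq ?_)
  rw [hL]
  ring


namespace BFI

/-! ### Unsifting for pairs of moduli -/

/-- Unsifting the progression sum costs only non-prime prime powers in `(x, 2x]`: for `z ≤ x`,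
`0 ≤ ∑_{x<n≤2x, n≡a} Λ(n) − ∑_{x<n≤2x, n≡a, (n,P(z))=1} Λ(n) ≤ ∑_{x<n≤2x, n ≡ a, n not prime} Λ(n)`.
[folklore] -/
theorem psiDyadMod_sub_sifted_le_Ioc {z x : ℝ} (hzx : z ≤ x) (q : ℕ) (a : ZMod q) :
    0 ≤ psiDyadMod q a x - psiDyadModSifted q a z x ∧
      psiDyadMod q a x - psiDyadModSifted q a z x ≤
        ∑ n ∈ Ioc ⌊x⌋₊ ⌊2 * x⌋₊,
          (if n.Prime then 0 else if (n : ZMod q) = a then Λ n else 0) := by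
  have hsub : psiDyadMod q a x - psiDyadModSifted q a z x =
      ∑ n ∈ Ioc ⌊x⌋₊ ⌊2 * x⌋₊,
        (if IsRough z n then 0 else ArithmeticFunction.vonMangoldt.residueClass a n) := by
    rw [psiDyadMod, psiDyadModSifted, ← Finset.sum_sub_distrib]
    refine Finset.sum_congr rfl fun n _ => ?_
    split_ifs <;> ring
  rw [hsub]
  refine ⟨Finset.sum_nonneg fun n _ => ?_, Finset.sum_le_sum fun n hn => ?_⟩
  · split_ifs
    · exact le_rfl
    · exact ArithmeticFunction.vonMangoldt.residueClass_nonneg _ _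
  · by_cases hr : IsRough z n
    · rw [if_pos hr]
      split_ifs <;> first | exact le_rfl | exact ArithmeticFunction.vonMangoldt_nonneg
    · rw [if_neg hr, if_neg (not_prime_of_not_isRough hzx hn hr)]
      simp only [ArithmeticFunction.vonMangoldt.residueClass, Set.indicator_apply,
        Set.mem_setOf_eq]
      exact le_rfl

/-- The cost of unsifting one modulus, with the non-prime prime powers kept in `(x, 2x]`: for
`z ≤ x` and `q ≥ 1`,
`|E(x; q, a) − E_z(x; q, a)| ≤ ∑_{x<n≤2x, n≡a, n not prime} Λ(n) + (ψ(2x) − ϑ(2x))/φ(q)`. [folklore] -/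
theorem abs_dyadDisc_sub_sifted_le_Ioc {z x : ℝ} (hzx : z ≤ x) {q : ℕ} (hq : 1 ≤ q) (a : ℤ) :
    |dyadDisc q a x - dyadDiscSifted q a z x| ≤
      (∑ n ∈ Ioc ⌊x⌋₊ ⌊2 * x⌋₊,
          (if n.Prime then 0 else if (n : ZMod q) = (a : ZMod q) then Λ n else 0)) +
        (ψ (2 * x) - θ (2 * x)) / (Nat.totient q : ℝ) := by
  obtain ⟨h1, h2⟩ := psiDyadMod_sub_sifted_le_Ioc hzx q (a : ZMod q)
  obtain ⟨h3, h4⟩ := psiDyadCoprime_sub_sifted_le hzx q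
  have hφ : 0 < (Nat.totient q : ℝ) := by exact_mod_cast Nat.totient_pos.2 hq
  have heq : dyadDisc q a x - dyadDiscSifted q a z x =
      (psiDyadMod q (a : ZMod q) x - psiDyadModSifted q (a : ZMod q) z x) -
        (psiDyadCoprime q x - psiDyadCoprimeSifted q z x) / (Nat.totient q : ℝ) := by
    unfold dyadDisc dyadDiscSifted; ring
  rw [heq]
  refine (abs_sub _ _).trans (add_le_add ?_ ?_)
  · rwa [abs_of_nonneg h1]
  · rw [abs_of_nonneg (div_nonneg h3 hφ.le)]
    exact div_le_div_of_nonneg_right h4 hφ.le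

/-- A congruence `n ≡ a (mod d)` (natural `n`, integer `a`) means `d ∣ n − a`. [folklore] -/
theorem natCast_eq_intCast_zmod_iff (n d : ℕ) (a : ℤ) :
    (n : ZMod d) = (a : ZMod d) ↔ (d : ℤ) ∣ (n : ℤ) - a := by
  rw [show (n : ZMod d) = ((n : ℤ) : ZMod d) by push_cast; rfl,
    ZMod.intCast_eq_intCast_iff_dvd_sub, dvd_sub_comm]

/-- **The non-prime prime powers in progressions to the moduli `qr`, `q ≤ Qn`, `r ≤ Rn`** (counted
with the multiplicity of the pair): for `x ≥ |a|`,
`∑_{r ≤ Rn} ∑_{q ≤ Qn} ∑_{x<n≤2x, n≡a (qr), n not prime} Λ(n) ≤ T · (ψ(2x) − ϑ(2x))` as soon as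
`τ(n − a)² ≤ T` for all `x < n ≤ 2x` (each such `n − a > 0` has at most `τ(n−a)²` factorisations
`qr ∣ n − a`). [folklore] -/
theorem sum_sum_nonPrime_progression_le (Qn Rn : ℕ) {a : ℤ} {x T : ℝ} (hx : |(a : ℝ)| ≤ x)
    (hT : ∀ n ∈ Ioc ⌊x⌋₊ ⌊2 * x⌋₊, (σ 0 ((n : ℤ) - a).natAbs : ℝ) ^ 2 ≤ T) (hT0 : 0 ≤ T) :
    ∑ r ∈ Icc 1 Rn, ∑ q ∈ Icc 1 Qn, ∑ n ∈ Ioc ⌊x⌋₊ ⌊2 * x⌋₊,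
        (if n.Prime then 0 else if (n : ZMod (q * r)) = (a : ZMod (q * r)) then Λ n else 0) ≤
      T * (ψ (2 * x) - θ (2 * x)) := by
  -- interchange: the sum over `n` first
  rw [Finset.sum_comm]
  rw [Finset.sum_congr rfl fun r _ => Finset.sum_comm]
  rw [Finset.sum_comm]
  -- now `∑ n, ∑ r, ∑ q`
  have hn : ∀ n ∈ Ioc ⌊x⌋₊ ⌊2 * x⌋₊, ∑ q ∈ Icc 1 Qn, ∑ r ∈ Icc 1 Rn,
      (if n.Prime then 0 else if (n : ZMod (q * r)) = (a : ZMod (q * r)) then Λ n else (0 : ℝ)) ≤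
      T * (if n.Prime then 0 else Λ n) := by
    intro n hn
    by_cases hp : n.Prime
    · simp [hp]
    rw [if_neg hp]
    have hxn : x < n := Nat.lt_of_floor_lt (mem_Ioc.1 hn).1
    have hna : (n : ℤ) - a ≠ 0 := by
      have : (a : ℝ) < n := ((le_abs_self (a : ℝ)).trans hx).trans_lt hxn
      have : a < (n : ℤ) := by exact_mod_cast this
      omega
    calc ∑ q ∈ Icc 1 Qn, ∑ r ∈ Icc 1 Rn,
          (if n.Prime then 0 else if (n : ZMod (q * r)) = (a : ZMod (q * r)) then Λ n else (0 : ℝ))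
        ≤ ∑ q ∈ Icc 1 Qn, ∑ r ∈ Icc 1 Rn,
            (Λ n * if (((q * r : ℕ) : ℤ)) ∣ (n : ℤ) - a then (1 : ℝ) else 0) := by
          refine Finset.sum_le_sum fun q _ => Finset.sum_le_sum fun r _ => ?_
          rw [if_neg hp]
          by_cases hc : (n : ZMod (q * r)) = (a : ZMod (q * r))
          · rw [if_pos hc, if_pos ((natCast_eq_intCast_zmod_iff n (q * r) a).1 hc), mul_one]
          · rw [if_neg hc]
            split_ifs <;> simp [ArithmeticFunction.vonMangoldt_nonneg]
      _ = Λ n * ∑ q ∈ Icc 1 Qn, ∑ r ∈ Icc 1 Rn,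
            (if (((q * r : ℕ) : ℤ)) ∣ (n : ℤ) - a then (1 : ℝ) else 0) := by
          rw [Finset.mul_sum]
          exact Finset.sum_congr rfl fun q _ => by rw [Finset.mul_sum]
      _ ≤ Λ n * T := by
          refine mul_le_mul_of_nonneg_left ?_ ArithmeticFunction.vonMangoldt_nonneg
          refine (sum_sum_dvd_indicator_le Qn Rn ((n : ℤ) - a)).trans ?_
          rw [if_neg hna]
          exact hT n hn
      _ = T * Λ n := mul_comm _ _
  refine (Finset.sum_le_sum hn).trans ?_
  rw [← Finset.mul_sum]
  refine mul_le_mul_of_nonneg_left ?_ hT0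
  have hsubset : Ioc ⌊x⌋₊ ⌊2 * x⌋₊ ⊆ Ioc 0 ⌊2 * x⌋₊ := fun n hn => by
    rw [mem_Ioc] at hn ⊢; omega
  calc ∑ n ∈ Ioc ⌊x⌋₊ ⌊2 * x⌋₊, (if n.Prime then (0 : ℝ) else Λ n)
      ≤ ∑ n ∈ Ioc 0 ⌊2 * x⌋₊, (if n.Prime then (0 : ℝ) else Λ n) :=
        Finset.sum_le_sum_of_subset_of_nonneg hsubset fun n _ _ => by
          split_ifs <;> first | exact le_rfl | exact ArithmeticFunction.vonMangoldt_nonneg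
    _ = ∑ n ∈ (Ioc 0 ⌊2 * x⌋₊).filter (fun n => ¬ n.Prime), (Λ n : ℝ) := by
        rw [Finset.sum_filter]
        exact Finset.sum_congr rfl fun n _ => by by_cases h : n.Prime <;> simp [h]
    _ = ψ (2 * x) - θ (2 * x) := (Chebyshev.psi_sub_theta_eq_sum_not_prime _).symm

end BFI

set_option maxHeartbeats 800000 in -- long assembly with ~50 hypotheses
/-- **Unsifting, for pairs of moduli** (BFI §15 p. 244: in (15.1) "`z` is any number `< x`"): the
sifted signed dyadic estimate for the moduli `qr` (any sifting level `z(x) ≤ x`) implies the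
unsifted one.  The difference consists of proper prime powers `p^k`, `k ≥ 2`, `p < z`, in `(x, 2x]`:
on the progression side each such `n` lies in at most `τ(n − a)² ≪ x^{1/4}` of the progressions
`a (mod qr)` and `∑ Λ(p^k) = ψ(2x) − ϑ(2x) ≤ 2√(2x) log 2x`; on the main-term side
`ψ(2x) − ϑ(2x)` is weighed against `∑_{q,r} 1/φ(qr) ≤ (1 + log Q)²(1 + log R)²`. PROVED.
[cite: BombieriFriedlanderIwaniecActa1986, §15 (15.1) p. 244; §16 p. 250] -/
theorem BFI.thm9Dyadic_of_sifted {a : ℤ} {z : ℝ → ℝ} (hz : ∀ᶠ x in atTop, z x ≤ x)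
    (h : ∀ ε : ℝ, 0 < ε → ∀ A : ℝ, 0 < A → ∃ B C x₀ : ℝ, ∀ x : ℝ, x₀ ≤ x → ∀ Q R : ℝ,
      R < x ^ (1 / 10 - ε) → Q * R < x / Real.log x ^ B → ∀ δ : ℕ → ℝ, (∀ r, |δ r| ≤ 1) →
        |∑ r ∈ (Icc 1 ⌊R⌋₊).filter (fun r : ℕ => IsCoprime (r : ℤ) a),
            δ r * ∑ q ∈ (Icc 1 ⌊Q⌋₊).filter (fun q : ℕ => IsCoprime (q : ℤ) a),
              dyadDiscSifted (q * r) a (z x) x| ≤ C * x / Real.log x ^ A)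
    {ε : ℝ} (hε : 0 < ε) {A : ℝ} (hA : 0 < A) :
    ∃ B C x₀ : ℝ, ∀ x : ℝ, x₀ ≤ x → ∀ Q R : ℝ,
      R < x ^ (1 / 10 - ε) → Q * R < x / Real.log x ^ B → ∀ δ : ℕ → ℝ, (∀ r, |δ r| ≤ 1) →
        |∑ r ∈ (Icc 1 ⌊R⌋₊).filter (fun r : ℕ => IsCoprime (r : ℤ) a),
            δ r * ∑ q ∈ (Icc 1 ⌊Q⌋₊).filter (fun q : ℕ => IsCoprime (q : ℤ) a),
              dyadDisc (q * r) a x| ≤ C * x / Real.log x ^ A := by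
  obtain ⟨B, C, x₀, hC⟩ := h ε hε A hA
  set C' : ℝ := max C 0 with hC'
  set B' : ℝ := max B 0 with hB'
  have hB'0 : 0 ≤ B' := le_max_right _ _
  obtain ⟨Cd, hCd1, hCd⟩ := exists_sigma_zero_le_mul_rpow (ε := 1 / 8) (by norm_num)
  have hCd0 : 0 ≤ Cd := zero_le_one.trans hCd1
  have hev : ∀ᶠ x : ℝ in atTop, 2 ≤ x ∧ 2 ≤ Real.log x ∧ x₀ ≤ x ∧ z x ≤ x ∧ |(a : ℝ)| ≤ x ∧
      128 * Real.log x ^ (A + 5) ≤ x ^ (1 / 2 : ℝ) ∧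
      16 * (Cd ^ 2 * 3) * Real.log x ^ (A + 1) ≤ x ^ (1 / 4 : ℝ) := by
    filter_upwards [eventually_ge_atTop (2 : ℝ), Real.tendsto_log_atTop.eventually_ge_atTop 2,
      eventually_ge_atTop x₀, hz, eventually_ge_atTop (|(a : ℝ)|),
      Real.tendsto_log_atTop.eventually_ge_atTop 128,
      Real.tendsto_log_atTop.eventually_ge_atTop (16 * (Cd ^ 2 * 3)),
      Literature.NumberTheory.Sieve.eventually_log_rpow_le_rpow (A + 6) one_half_pos,
      Literature.NumberTheory.Sieve.eventually_log_rpow_le_rpow (A + 2)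
        (by norm_num : (0 : ℝ) < 1 / 4)]
      with x h1 h2 h3 h4 h5 h6 h7 h8 h9
    have hL0 : 0 < Real.log x := by linarith
    have hsplit : ∀ r : ℝ, Real.log x ^ (r + 1) = Real.log x ^ r * Real.log x := fun r => by
      rw [Real.rpow_add hL0, Real.rpow_one]
    refine ⟨h1, h2, h3, h4, h5, ?_, ?_⟩
    · calc 128 * Real.log x ^ (A + 5) ≤ Real.log x * Real.log x ^ (A + 5) :=
            mul_le_mul_of_nonneg_right h6 (by positivity)
        _ = Real.log x ^ (A + 6) := by rw [show A + 6 = (A + 5) + 1 by ring, hsplit (A + 5)]; ring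
        _ ≤ x ^ (1 / 2 : ℝ) := h8
    · calc 16 * (Cd ^ 2 * 3) * Real.log x ^ (A + 1) ≤ Real.log x * Real.log x ^ (A + 1) :=
            mul_le_mul_of_nonneg_right h7 (by positivity)
        _ = Real.log x ^ (A + 2) := by rw [show A + 2 = (A + 1) + 1 by ring, hsplit (A + 1)]; ring
        _ ≤ x ^ (1 / 4 : ℝ) := h9
  obtain ⟨x₁, hx₁⟩ := Filter.eventually_atTop.1 hev
  refine ⟨B', C' + 2, x₁, fun x hx Q R hR hQR δ hδ => ?_⟩
  obtain ⟨hx2, hL2, hxx₀, hzx, hxa, hLx, hLx4⟩ := hx₁ x hx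
  -- notation
  set L : ℝ := Real.log x with hL
  set SR : Finset ℕ := (Icc 1 ⌊R⌋₊).filter (fun r : ℕ => IsCoprime (r : ℤ) a) with hSR
  set SQ : Finset ℕ := (Icc 1 ⌊Q⌋₊).filter (fun q : ℕ => IsCoprime (q : ℤ) a) with hSQ
  have hx1 : (1 : ℝ) ≤ x := by linarith
  have hx0 : (0 : ℝ) ≤ x := by linarith
  have hxpos : (0 : ℝ) < x := by linarith
  have hL0 : 0 < L := by linarith
  have hL1 : 1 ≤ L := by linarith
  have hLA0 : 0 < L ^ A := Real.rpow_pos_of_pos hL0 A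
  -- Step 1: the sifted estimate (the level `x/L^{B'}` is at most `x/L^B`)
  have hQR' : Q * R < x / Real.log x ^ B := by
    refine hQR.trans_le (div_le_div_of_nonneg_left hx0 (Real.rpow_pos_of_pos hL0 _) ?_)
    exact Real.rpow_le_rpow_of_exponent_le hL1 (le_max_left _ _)
  have h1 : |∑ r ∈ SR, δ r * ∑ q ∈ SQ, dyadDiscSifted (q * r) a (z x) x| ≤ C' * x / L ^ A := by
    refine (hC x hxx₀ Q R hR hQR' δ hδ).trans ?_
    have h0 : 0 ≤ x / L ^ A := by positivity
    calc C * x / Real.log x ^ A = C * (x / L ^ A) := by rw [hL]; ring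
      _ ≤ C' * (x / L ^ A) := mul_le_mul_of_nonneg_right (le_max_left _ _) h0
      _ = C' * x / L ^ A := by ring
  -- Step 2: the unsifting cost, pair by pair
  set NP : ℕ → ℝ := fun d => ∑ n ∈ Ioc ⌊x⌋₊ ⌊2 * x⌋₊,
    (if n.Prime then 0 else if (n : ZMod d) = (a : ZMod d) then Λ n else 0) with hNPdef
  have hpt : 0 ≤ ψ (2 * x) - θ (2 * x) := sub_nonneg.2 (Chebyshev.theta_le_psi _)
  have hdiff : |(∑ r ∈ SR, δ r * ∑ q ∈ SQ, dyadDisc (q * r) a x) -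
      ∑ r ∈ SR, δ r * ∑ q ∈ SQ, dyadDiscSifted (q * r) a (z x) x| ≤
      ∑ r ∈ Icc 1 ⌊R⌋₊, ∑ q ∈ Icc 1 ⌊Q⌋₊, (NP (q * r) + (ψ (2 * x) - θ (2 * x)) / (Nat.totient (q * r) : ℝ)) := by
    rw [← Finset.sum_sub_distrib]
    refine (Finset.abs_sum_le_sum_abs _ _).trans ?_
    refine (Finset.sum_le_sum_of_subset_of_nonneg (Finset.filter_subset _ _)
      fun _ _ _ => abs_nonneg _).trans (Finset.sum_le_sum fun r hr => ?_)
    have hr1 : 1 ≤ r := (mem_Icc.1 hr).1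
    rw [← mul_sub, abs_mul, ← Finset.sum_sub_distrib]
    calc |δ r| * |∑ q ∈ SQ, (dyadDisc (q * r) a x - dyadDiscSifted (q * r) a (z x) x)|
        ≤ 1 * |∑ q ∈ SQ, (dyadDisc (q * r) a x - dyadDiscSifted (q * r) a (z x) x)| :=
          mul_le_mul_of_nonneg_right (hδ r) (abs_nonneg _)
      _ ≤ ∑ q ∈ SQ, |dyadDisc (q * r) a x - dyadDiscSifted (q * r) a (z x) x| := by
          rw [one_mul]; exact Finset.abs_sum_le_sum_abs _ _
      _ ≤ ∑ q ∈ Icc 1 ⌊Q⌋₊, |dyadDisc (q * r) a x - dyadDiscSifted (q * r) a (z x) x| :=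
          Finset.sum_le_sum_of_subset_of_nonneg (Finset.filter_subset _ _) fun _ _ _ => abs_nonneg _
      _ ≤ ∑ q ∈ Icc 1 ⌊Q⌋₊, (NP (q * r) + (ψ (2 * x) - θ (2 * x)) / (Nat.totient (q * r) : ℝ)) :=
          Finset.sum_le_sum fun q hq =>
            abs_dyadDisc_sub_sifted_le_Ioc hzx (Nat.mul_pos (mem_Icc.1 hq).1 hr1) a
  -- Step 3: the progression side
  have hT : ∀ n ∈ Ioc ⌊x⌋₊ ⌊2 * x⌋₊, (σ 0 ((n : ℤ) - a).natAbs : ℝ) ^ 2 ≤ Cd ^ 2 * (3 * x) ^ (1 / 4 : ℝ) := by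
    intro n hn
    have hn2 : (n : ℝ) ≤ 2 * x := by
      have := (mem_Ioc.1 hn).2
      exact (Nat.cast_le.2 this).trans (Nat.floor_le (by linarith))
    have hm : (((n : ℤ) - a).natAbs : ℝ) ≤ 3 * x := by
      have h1 : (((n : ℤ) - a).natAbs : ℝ) = |((n : ℝ) - a)| := by
        rw [Nat.cast_natAbs]; push_cast; rfl
      rw [h1]
      calc |(n : ℝ) - a| ≤ |(n : ℝ)| + |(a : ℝ)| := abs_sub _ _
        _ ≤ 2 * x + x := add_le_add (by rw [abs_of_nonneg (Nat.cast_nonneg _)]; exact hn2) hxa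
        _ = 3 * x := by ring
    calc (σ 0 ((n : ℤ) - a).natAbs : ℝ) ^ 2 ≤ (Cd * (((n : ℤ) - a).natAbs : ℝ) ^ (1 / 8 : ℝ)) ^ 2 :=
          pow_le_pow_left₀ (Nat.cast_nonneg _) (hCd _) 2
      _ = Cd ^ 2 * ((((n : ℤ) - a).natAbs : ℝ) ^ (1 / 8 : ℝ)) ^ 2 := by ring
      _ ≤ Cd ^ 2 * ((3 * x) ^ (1 / 8 : ℝ)) ^ 2 := by
          gcongr
      _ = Cd ^ 2 * (3 * x) ^ (1 / 4 : ℝ) := by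
          rw [← Real.rpow_natCast ((3 * x) ^ (1 / 8 : ℝ)) 2, ← Real.rpow_mul (by linarith)]
          norm_num
  have hpt' : ψ (2 * x) - θ (2 * x) ≤ 8 * Real.sqrt x * L := by
    refine (Chebyshev.psi_sub_theta_le (by linarith : (1 : ℝ) ≤ 2 * x)).trans ?_
    have hs : Real.sqrt (2 * x) ≤ 2 * Real.sqrt x := by
      rw [Real.sqrt_le_left (by positivity)]
      nlinarith [Real.sq_sqrt hx0, Real.sqrt_nonneg x]
    have hl : Real.log (2 * x) ≤ 2 * L := by
      rw [Real.log_mul two_ne_zero (by linarith), hL]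
      have : Real.log 2 ≤ Real.log x := Real.log_le_log two_pos hx2
      linarith
    have hl0 : 0 ≤ Real.log (2 * x) := Real.log_nonneg (by linarith)
    calc 2 * Real.sqrt (2 * x) * Real.log (2 * x) ≤ 2 * (2 * Real.sqrt x) * (2 * L) := by gcongr
      _ = 8 * Real.sqrt x * L := by ring
  have hNP_le : ∑ r ∈ Icc 1 ⌊R⌋₊, ∑ q ∈ Icc 1 ⌊Q⌋₊, NP (q * r) ≤ x / L ^ A := by
    refine (sum_sum_nonPrime_progression_le ⌊Q⌋₊ ⌊R⌋₊ hxa hT (by positivity)).trans ?_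
    have h3x : (3 * x) ^ (1 / 4 : ℝ) ≤ 3 * x ^ (1 / 4 : ℝ) := by
      rw [Real.mul_rpow (by norm_num) hx0]
      refine mul_le_mul_of_nonneg_right ?_ (Real.rpow_nonneg hx0 _)
      calc (3 : ℝ) ^ (1 / 4 : ℝ) ≤ (3 : ℝ) ^ (1 : ℝ) := Real.rpow_le_rpow_of_exponent_le (by norm_num) (by norm_num)
        _ = 3 := Real.rpow_one 3
    calc Cd ^ 2 * (3 * x) ^ (1 / 4 : ℝ) * (ψ (2 * x) - θ (2 * x))
        ≤ Cd ^ 2 * (3 * x ^ (1 / 4 : ℝ)) * (8 * Real.sqrt x * L) :=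
          mul_le_mul (mul_le_mul_of_nonneg_left h3x (by positivity)) hpt' hpt (by positivity)
      _ = 8 * (Cd ^ 2 * 3) * L * (x ^ (1 / 4 : ℝ) * Real.sqrt x) := by ring
      _ ≤ x / L ^ A := by
          rw [le_div_iff₀ hLA0]
          have hLA1 : L ^ A * L = L ^ (A + 1) := by rw [Real.rpow_add hL0, Real.rpow_one]
          have hx14 : x ^ (1 / 4 : ℝ) * x ^ (1 / 4 : ℝ) * Real.sqrt x = x := by
            rw [Real.sqrt_eq_rpow, ← Real.rpow_add hxpos, ← Real.rpow_add hxpos]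
            norm_num
          calc 8 * (Cd ^ 2 * 3) * L * (x ^ (1 / 4 : ℝ) * Real.sqrt x) * L ^ A
              = 8 * (Cd ^ 2 * 3) * L ^ (A + 1) * (x ^ (1 / 4 : ℝ) * Real.sqrt x) := by
                rw [← hLA1]; ring
            _ ≤ x ^ (1 / 4 : ℝ) * (x ^ (1 / 4 : ℝ) * Real.sqrt x) := by
                refine mul_le_mul_of_nonneg_right ?_ (by positivity)
                have h0 : 0 ≤ Cd ^ 2 * 3 * L ^ (A + 1) := by positivity
                nlinarith [h0, hLx4]
            _ = x := by rw [← mul_assoc, hx14]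
  -- Step 4: the main-term side
  have hMT_le : ∑ r ∈ Icc 1 ⌊R⌋₊, ∑ q ∈ Icc 1 ⌊Q⌋₊, (ψ (2 * x) - θ (2 * x)) / (Nat.totient (q * r) : ℝ) ≤
      x / L ^ A := by
    -- degenerate `Q < 1` or `R < 1`: the sum is empty; else `log ⌊Q⌋, log ⌊R⌋ ≤ L`
    by_cases hR1 : ⌊R⌋₊ = 0
    · rw [hR1]; simp only [show (Icc 1 0 : Finset ℕ) = ∅ from rfl, Finset.sum_empty]; positivity
    by_cases hQ1 : ⌊Q⌋₊ = 0
    · rw [hQ1]; simp only [show (Icc 1 0 : Finset ℕ) = ∅ from rfl, Finset.sum_empty, Finset.sum_const_zero]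
      positivity
    have hR1' : 1 ≤ R := by
      by_contra hlt; exact hR1 (Nat.floor_eq_zero.2 (by linarith))
    have hQ1' : 1 ≤ Q := by
      by_contra hlt; exact hQ1 (Nat.floor_eq_zero.2 (by linarith))
    have hLB0 : 0 < L ^ B' := Real.rpow_pos_of_pos hL0 _
    have hQRx : Q * R < x := by
      refine hQR.trans_le ?_
      rw [div_le_iff₀ hLB0]
      have : 1 ≤ L ^ B' := Real.one_le_rpow hL1 hB'0
      nlinarith
    have hQx : (⌊Q⌋₊ : ℝ) ≤ x := (Nat.floor_le (by linarith)).trans (by nlinarith)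
    have hRx : (⌊R⌋₊ : ℝ) ≤ x := (Nat.floor_le (by linarith)).trans (by nlinarith)
    have hQn1 : (1 : ℝ) ≤ ⌊Q⌋₊ := by exact_mod_cast Nat.pos_of_ne_zero hQ1
    have hRn1 : (1 : ℝ) ≤ ⌊R⌋₊ := by exact_mod_cast Nat.pos_of_ne_zero hR1
    have hlogQn : Real.log ⌊Q⌋₊ ≤ L := Real.log_le_log (by linarith) hQx
    have hlogRn : Real.log ⌊R⌋₊ ≤ L := Real.log_le_log (by linarith) hRx
    have hlogQn0 : 0 ≤ Real.log ⌊Q⌋₊ := Real.log_natCast_nonneg _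
    have hlogRn0 : 0 ≤ Real.log ⌊R⌋₊ := Real.log_natCast_nonneg _
    calc ∑ r ∈ Icc 1 ⌊R⌋₊, ∑ q ∈ Icc 1 ⌊Q⌋₊, (ψ (2 * x) - θ (2 * x)) / (Nat.totient (q * r) : ℝ)
        = (ψ (2 * x) - θ (2 * x)) * ∑ r ∈ Icc 1 ⌊R⌋₊, ∑ q ∈ Icc 1 ⌊Q⌋₊, ((Nat.totient (q * r) : ℝ))⁻¹ := by
          rw [Finset.mul_sum]
          refine Finset.sum_congr rfl fun r _ => ?_
          rw [Finset.mul_sum]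
          exact Finset.sum_congr rfl fun q _ => by rw [div_eq_mul_inv]
      _ ≤ (8 * Real.sqrt x * L) * (16 * L ^ 4) := by
          refine mul_le_mul hpt' ((sum_sum_totient_mul_inv_le ⌊Q⌋₊ ⌊R⌋₊).trans ?_)
            (Finset.sum_nonneg fun _ _ => Finset.sum_nonneg fun _ _ => inv_nonneg.2 (Nat.cast_nonneg _))
            (by positivity)
          have h1 : (1 + Real.log ⌊Q⌋₊) ^ 2 ≤ 4 * L ^ 2 := by nlinarith
          have h2 : (1 + Real.log ⌊R⌋₊) ^ 2 ≤ 4 * L ^ 2 := by nlinarith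
          calc _ ≤ (4 * L ^ 2) * (4 * L ^ 2) := mul_le_mul h1 h2 (by positivity) (by positivity)
            _ = 16 * L ^ 4 := by ring
      _ = 128 * Real.sqrt x * L ^ 5 := by ring
      _ ≤ x / L ^ A := by
          rw [le_div_iff₀ hLA0]
          have hLA5 : L ^ 5 * L ^ A = L ^ (A + 5) := by
            rw [Real.rpow_add hL0, show (5 : ℝ) = ((5 : ℕ) : ℝ) by norm_num, Real.rpow_natCast]; ring
          have hsq : Real.sqrt x * Real.sqrt x = x := Real.mul_self_sqrt hx0
          have hxhalf : x ^ (1 / 2 : ℝ) = Real.sqrt x := (Real.sqrt_eq_rpow x).symm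
          calc 128 * Real.sqrt x * L ^ 5 * L ^ A = 128 * L ^ (A + 5) * Real.sqrt x := by
                rw [← hLA5]; ring
            _ ≤ Real.sqrt x * Real.sqrt x := by
                rw [← hxhalf] at *
                exact mul_le_mul_of_nonneg_right hLx (by positivity)
            _ = x := hsq
  -- conclusion
  have hmain : |∑ r ∈ SR, δ r * ∑ q ∈ SQ, dyadDisc (q * r) a x| ≤ C' * x / L ^ A + (x / L ^ A + x / L ^ A) := by
    have htri := abs_sub_abs_le_abs_sub (∑ r ∈ SR, δ r * ∑ q ∈ SQ, dyadDisc (q * r) a x)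
      (∑ r ∈ SR, δ r * ∑ q ∈ SQ, dyadDiscSifted (q * r) a (z x) x)
    have hd : ∑ r ∈ Icc 1 ⌊R⌋₊, ∑ q ∈ Icc 1 ⌊Q⌋₊, (NP (q * r) + (ψ (2 * x) - θ (2 * x)) / (Nat.totient (q * r) : ℝ))
        ≤ x / L ^ A + x / L ^ A := by
      rw [show ∑ r ∈ Icc 1 ⌊R⌋₊, ∑ q ∈ Icc 1 ⌊Q⌋₊, (NP (q * r) + (ψ (2 * x) - θ (2 * x)) / (Nat.totient (q * r) : ℝ))
          = (∑ r ∈ Icc 1 ⌊R⌋₊, ∑ q ∈ Icc 1 ⌊Q⌋₊, NP (q * r)) +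
            ∑ r ∈ Icc 1 ⌊R⌋₊, ∑ q ∈ Icc 1 ⌊Q⌋₊, (ψ (2 * x) - θ (2 * x)) / (Nat.totient (q * r) : ℝ) by
        rw [← Finset.sum_add_distrib]
        exact Finset.sum_congr rfl fun r _ => Finset.sum_add_distrib]
      exact add_le_add hNP_le hMT_le
    linarith [hdiff.trans hd]
  refine hmain.trans (le_of_eq ?_)
  rw [hL]; ring


/-- **Theorem 9 from the sifted signed dyadic estimate for pairs of moduli.**  If for some sifting
level `z(x) ≤ x` (eventually) and every `a ≠ 0`, `ε > 0`, `A > 0` there are `B, C, x₀` with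
`|∑_{r ≤ R, (r,a)=1} δ_r ∑_{q ≤ Q, (q,a)=1} E_{z(x)}(x; qr, a)| ≤ C x ℒ^{−A}` for all `x ≥ x₀`,
`R < x^{1/10−ε}`, `QR < x ℒ^{−B}` and real `|δ_r| ≤ 1` (the shape (15.1), p. 244, of what §16 derives
from Theorems 6 and 7*), then `BombieriFriedlanderIwaniecTheorem9` holds: compose
`BFI.thm9Dyadic_of_sifted`, `BFI.thm9Signed_of_dyadic` and
`BombieriFriedlanderIwaniecTheorem9.of_signed`.
[cite: BombieriFriedlanderIwaniecActa1986, §15 (15.1) p. 244; §16 p. 250] -/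
theorem BombieriFriedlanderIwaniecTheorem9.of_sifted {z : ℝ → ℝ} (hz : ∀ᶠ x in atTop, z x ≤ x)
    (h : ∀ a : ℤ, a ≠ 0 → ∀ ε : ℝ, 0 < ε → ∀ A : ℝ, 0 < A → ∃ B C x₀ : ℝ, ∀ x : ℝ, x₀ ≤ x →
      ∀ Q R : ℝ, R < x ^ (1 / 10 - ε) → Q * R < x / Real.log x ^ B → ∀ δ : ℕ → ℝ,
        (∀ r, |δ r| ≤ 1) →
        |∑ r ∈ (Icc 1 ⌊R⌋₊).filter (fun r : ℕ => IsCoprime (r : ℤ) a),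
            δ r * ∑ q ∈ (Icc 1 ⌊Q⌋₊).filter (fun q : ℕ => IsCoprime (q : ℤ) a),
              dyadDiscSifted (q * r) a (z x) x| ≤ C * x / Real.log x ^ A) :
    BombieriFriedlanderIwaniecTheorem9 :=
  BombieriFriedlanderIwaniecTheorem9.of_signed fun _ ha _ hε _ hA =>
    BFI.thm9Signed_of_dyadic (fun _ hε' _ hA' => BFI.thm9Dyadic_of_sifted hz (h _ ha) hε' hA') hε hA

end Literature.NumberTheory.Sieve
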